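import Summits.HubbardSuperconductivity.HubbardSuperconductivity.Theorems.WidthHaldaneDefs

/-!
# Dirichlet block sums on `ℤ/N`: closed forms and the dual transverse Fermi level

Elementary trigonometric sums for the free-fermion numbers of the tube cruxes (routes `WidthHaldane`,
`SeamInduction`; items stmt-HubbardSuperconductivity-16311/16312/18509/18510), all PROVED, no
definitions, no named facts; used by `WidthHaldaneTubeFreeKineticNumber` to evaluate the kinetic floor
of `WidthHaldaneTubeKineticWindow` in closed form. With `S(m,N) = sin((2m+1)π/N)/sin(π/N)`:

* `two_sin_half_mul_sum_cos_shift`, `sin_half_mul_one_add_two_mul_sum_cos` — the Dirichlet kernel,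
  telescoped / by induction; `sum_cos_shift_eq`, `one_add_two_mul_sum_cos_eq` — `Σ_{|j|≤m} cos(2πj/N) = S(m,N)`
  (`N ≥ 2`);
* `cos_two_pi_mul_val_intCast` — `cos(2π·val(z mod N)/N) = cos(2πz/N)`; `block_injOn`, `card_block`,
  **`sum_block_cos_eq`** — the centred block `{j - m : 0 ≤ j ≤ 2m} ⊂ ℤ/N` (`2m+1 ≤ N`) has `2m+1`
  elements and cosine sum `S(m,N)`;
* `cos_ge_of_abs_le`, `cos_le_of_mem_middle`, `val_mem_middle_of_not_mem_block` — monotonicity of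
  `cos(2π·/N)` towards the zone boundary, inside/outside the block;
* **`sum_posPart_two_cos_sub_eq`** — the dual Fermi level of the transverse band: with `c = cos(2πm/M)`
  (`1 ≤ m`, `2m ≤ M`), `Σ_{b ∈ ℤ/M} (2cos(2πb/M) - 2c)₊ = 2S(m-1,M) - (2m-1)·2c`.

References: standard (Dirichlet kernel); E. H. Lieb, M. Loss, *Analysis* (2001) Thm 1.14 (bathtub
duality, where these sums enter).
-/

noncomputable section

namespace Summit.HubbardSuperconductivity.HubbardSuperconductivity.Theorems.WidthHaldane

set_option linter.dupNamespace false -- summit = problem name (single-conjunct summit), D-0017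

open scoped BigOperators Classical

section Trig

/-- `2 sin(θ/2) cos(xθ) = sin((x + ½)θ) - sin((x - ½)θ)`. [folklore] -/
theorem two_sin_half_mul_cos (θ x : ℝ) :
    2 * Real.sin (θ / 2) * Real.cos (x * θ) = Real.sin ((x + 1 / 2) * θ) - Real.sin ((x - 1 / 2) * θ) := by
  have h1 : (x + 1 / 2) * θ = x * θ + θ / 2 := by ring
  have h2 : (x - 1 / 2) * θ = x * θ - θ / 2 := by ring
  rw [h1, h2, Real.sin_add, Real.sin_sub]
  ring

/-- **The shifted Dirichlet sum, telescoped**: `2 sin(θ/2) Σ_{j=0}^{2m} cos((j - m)θ) = 2 sin((m + ½)θ)`.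
[folklore] -/
theorem two_sin_half_mul_sum_cos_shift (m : ℕ) (θ : ℝ) :
    2 * Real.sin (θ / 2) * ∑ j ∈ Finset.range (2 * m + 1), Real.cos (((j : ℝ) - m) * θ) =
      2 * Real.sin (((m : ℝ) + 1 / 2) * θ) := by
  rw [Finset.mul_sum]
  have h : ∀ j : ℕ, 2 * Real.sin (θ / 2) * Real.cos (((j : ℝ) - m) * θ) =
      Real.sin ((((j + 1 : ℕ) : ℝ) - m - 1 / 2) * θ) - Real.sin ((((j : ℕ) : ℝ) - m - 1 / 2) * θ) := by
    intro j
    rw [two_sin_half_mul_cos]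
    push_cast
    ring_nf
  simp_rw [h]
  rw [Finset.sum_range_sub (fun j : ℕ => Real.sin (((j : ℝ) - m - 1 / 2) * θ))]
  push_cast
  have h3 : ((2 * (m : ℝ) + 1) - m - 1 / 2) * θ = ((m : ℝ) + 1 / 2) * θ := by ring
  have h4 : ((0 : ℝ) - m - 1 / 2) * θ = -(((m : ℝ) + 1 / 2) * θ) := by ring
  rw [h3, h4, Real.sin_neg]
  ring

/-- **The symmetric Dirichlet sum by induction**: `sin(θ/2) (1 + 2Σ_{u=1}^{m} cos(uθ)) = sin((2m+1)θ/2)`.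
[folklore] -/
theorem sin_half_mul_one_add_two_mul_sum_cos (m : ℕ) (θ : ℝ) :
    Real.sin (θ / 2) * (1 + 2 * ∑ u ∈ Finset.range m, Real.cos (((u : ℝ) + 1) * θ)) =
      Real.sin ((2 * (m : ℝ) + 1) * θ / 2) := by
  induction m with
  | zero => simp
  | succ m ih =>
    rw [Finset.sum_range_succ, mul_add 2, ← add_assoc, mul_add (Real.sin (θ / 2)), ih]
    have h := two_sin_half_mul_cos θ ((m : ℝ) + 1)
    have h1 : (((m : ℝ) + 1) + 1 / 2) * θ = (2 * (((m + 1 : ℕ)) : ℝ) + 1) * θ / 2 := by push_cast; ring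
    have h2 : (((m : ℝ) + 1) - 1 / 2) * θ = (2 * (m : ℝ) + 1) * θ / 2 := by ring
    rw [h1, h2] at h
    linarith

/-- `sin(π/N) > 0` for `N ≥ 2`. [folklore] -/
theorem sin_pi_div_pos {N : ℕ} (hN : 2 ≤ N) : 0 < Real.sin (Real.pi / N) := by
  have hN0 : (0 : ℝ) < N := by exact_mod_cast (show 0 < N by omega)
  have hN2 : (2 : ℝ) ≤ N := by exact_mod_cast hN
  refine Real.sin_pos_of_pos_of_lt_pi (by positivity) ?_
  rw [div_lt_iff₀ hN0]
  nlinarith [Real.pi_pos]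

/-- **Closed form of the shifted Dirichlet sum**: `Σ_{j=0}^{2m} cos(2π(j - m)/N) = sin((2m+1)π/N)/sin(π/N)`
(`N ≥ 2`). [folklore] -/
theorem sum_cos_shift_eq (m : ℕ) {N : ℕ} (hN : 2 ≤ N) :
    ∑ j ∈ Finset.range (2 * m + 1), Real.cos (((j : ℝ) - m) * (2 * Real.pi / N)) =
      Real.sin ((2 * (m : ℝ) + 1) * Real.pi / N) / Real.sin (Real.pi / N) := by
  have hs := sin_pi_div_pos hN
  have h := two_sin_half_mul_sum_cos_shift m (2 * Real.pi / N)
  have e1 : 2 * Real.pi / N / 2 = Real.pi / N := by ring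
  have e2 : ((m : ℝ) + 1 / 2) * (2 * Real.pi / N) = (2 * (m : ℝ) + 1) * Real.pi / N := by ring
  rw [e1, e2] at h
  rw [eq_div_iff hs.ne']
  linarith

/-- **Closed form of the symmetric Dirichlet sum**: `1 + 2Σ_{u=1}^{m} cos(2πu/N) = sin((2m+1)π/N)/sin(π/N)`
(`N ≥ 2`). [folklore] -/
theorem one_add_two_mul_sum_cos_eq (m : ℕ) {N : ℕ} (hN : 2 ≤ N) :
    1 + 2 * ∑ u ∈ Finset.range m, Real.cos (((u : ℝ) + 1) * (2 * Real.pi / N)) =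
      Real.sin ((2 * (m : ℝ) + 1) * Real.pi / N) / Real.sin (Real.pi / N) := by
  have hs := sin_pi_div_pos hN
  have h := sin_half_mul_one_add_two_mul_sum_cos m (2 * Real.pi / N)
  have e1 : 2 * Real.pi / N / 2 = Real.pi / N := by ring
  have e2 : (2 * (m : ℝ) + 1) * (2 * Real.pi / N) / 2 = (2 * (m : ℝ) + 1) * Real.pi / N := by ring
  rw [e1, e2] at h
  rw [eq_div_iff hs.ne']
  linarith

end Trig

section Block

variable {N : ℕ} [NeZero N]

/-- `cos(2π·val(z mod N)/N) = cos(2πz/N)` for every integer `z` (the representative differs from `z` by a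
multiple of `N`). [folklore] -/
theorem cos_two_pi_mul_val_intCast (z : ℤ) :
    Real.cos (2 * Real.pi * (((z : ZMod N).val : ℕ) : ℝ) / N) = Real.cos (2 * Real.pi * (z : ℝ) / N) := by
  have hN0 : (N : ℝ) ≠ 0 := by exact_mod_cast (NeZero.ne N)
  have h : (((z : ZMod N).val : ℕ) : ℤ) = z % (N : ℤ) := ZMod.val_intCast z
  have h3 : ((((z : ZMod N).val : ℕ) : ℝ)) = (z : ℝ) - (N : ℝ) * ((z / (N : ℤ) : ℤ) : ℝ) := by
    have h4 := congrArg (fun t : ℤ => (t : ℝ)) h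
    simp only [Int.cast_natCast] at h4
    rw [Int.emod_def] at h4
    push_cast at h4
    exact h4
  rw [h3]
  have h5 : 2 * Real.pi * ((z : ℝ) - N * ((z / (N : ℤ) : ℤ) : ℝ)) / N =
      2 * Real.pi * (z : ℝ) / N - ((z / (N : ℤ) : ℤ) : ℝ) * (2 * Real.pi) := by
    field_simp
  rw [h5, Real.cos_sub_int_mul_two_pi]

omit [NeZero N] in
/-- The block `{j - m : 0 ≤ j ≤ 2m} ⊂ ℤ/N` has `2m + 1` elements when `2m + 1 ≤ N`. [folklore] -/
theorem block_injOn (m : ℕ) (h : 2 * m + 1 ≤ N) :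
    Set.InjOn (fun j : ℕ => ((j : ZMod N) - (m : ZMod N))) (Finset.range (2 * m + 1) : Set ℕ) := by
  intro j₁ hj₁ j₂ hj₂ hj
  simp only [Finset.coe_range, Set.mem_Iio] at hj₁ hj₂
  have hj' : ((j₁ : ZMod N)) = (j₂ : ZMod N) := sub_left_injective hj
  have h1 := (ZMod.natCast_eq_natCast_iff' j₁ j₂ N).1 hj'
  rwa [Nat.mod_eq_of_lt (by omega), Nat.mod_eq_of_lt (by omega)] at h1

omit [NeZero N] in
/-- Hence `#{j - m : 0 ≤ j ≤ 2m} = 2m + 1` in `ℤ/N` (`2m + 1 ≤ N`). [folklore] -/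
theorem card_block (m : ℕ) (h : 2 * m + 1 ≤ N) :
    ((Finset.range (2 * m + 1)).image fun j : ℕ => ((j : ZMod N) - (m : ZMod N))).card = 2 * m + 1 := by
  rw [Finset.card_image_of_injOn (block_injOn m h), Finset.card_range]

/-- **The cosine sum over a centred block of `ℤ/N`** (`2m + 1 ≤ N`):
`Σ_{a ∈ block} cos(2π a/N) = sin((2m+1)π/N)/sin(π/N)`. [folklore] -/
theorem sum_block_cos_eq (m : ℕ) (hN : 2 ≤ N) (h : 2 * m + 1 ≤ N) :
    ∑ a ∈ (Finset.range (2 * m + 1)).image (fun j : ℕ => ((j : ZMod N) - (m : ZMod N))),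
        Real.cos (2 * Real.pi * (a.val : ℝ) / N) =
      Real.sin ((2 * (m : ℝ) + 1) * Real.pi / N) / Real.sin (Real.pi / N) := by
  rw [Finset.sum_image (block_injOn m h), ← sum_cos_shift_eq m hN]
  refine Finset.sum_congr rfl fun j _ => ?_
  have hz : ((j : ZMod N) - (m : ZMod N)) = (((j : ℤ) - (m : ℤ) : ℤ) : ZMod N) := by push_cast; ring
  rw [hz, cos_two_pi_mul_val_intCast]
  congr 1
  push_cast
  ring

end Block

section TransverseBand

variable (M : ℕ) [NeZero M]

omit [NeZero M] in
/-- Inside the block: `cos(2πz/M) ≥ cos(2πm/M)` for `|z| ≤ m` and `2m ≤ M`. [folklore] -/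
theorem cos_ge_of_abs_le {m : ℕ} (hm : 2 * m ≤ M) (hM : 0 < M) {z : ℤ} (hz : |z| ≤ (m : ℤ)) :
    Real.cos (2 * Real.pi * (m : ℝ) / M) ≤ Real.cos (2 * Real.pi * (z : ℝ) / M) := by
  have hM0 : (0 : ℝ) < M := by exact_mod_cast hM
  have hzr : |(z : ℝ)| ≤ m := by exact_mod_cast hz
  have hmM : 2 * (m : ℝ) ≤ M := by exact_mod_cast hm
  rw [← Real.cos_abs (2 * Real.pi * (z : ℝ) / M)]
  have habs : |2 * Real.pi * (z : ℝ) / M| = 2 * Real.pi * |(z : ℝ)| / M := by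
    rw [abs_div, abs_mul, abs_of_pos (by positivity : (0 : ℝ) < 2 * Real.pi), abs_of_pos hM0]
  rw [habs]
  refine Real.cos_le_cos_of_nonneg_of_le_pi (by positivity) ?_ ?_
  · rw [div_le_iff₀ hM0]
    nlinarith [Real.pi_pos]
  · exact div_le_div_of_nonneg_right (by nlinarith [Real.pi_pos, abs_nonneg (z : ℝ)]) hM0.le

omit [NeZero M] in
/-- Outside the block: `cos(2πv/M) ≤ cos(2πm/M)` for `m ≤ v ≤ M - m`. [folklore] -/
theorem cos_le_of_mem_middle {m v : ℕ} (hmv : m ≤ v) (hvM : v + m ≤ M) :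
    Real.cos (2 * Real.pi * (v : ℝ) / M) ≤ Real.cos (2 * Real.pi * (m : ℝ) / M) := by
  rcases Nat.eq_zero_or_pos M with hM | hM
  · subst hM
    have hv : v = 0 := by omega
    have hm : m = 0 := by omega
    simp [hv, hm]
  have hM0 : (0 : ℝ) < M := by exact_mod_cast hM
  have hmv' : (m : ℝ) ≤ v := by exact_mod_cast hmv
  have hvM' : (v : ℝ) + m ≤ M := by exact_mod_cast hvM
  by_cases h2 : 2 * v ≤ M
  · have h2' : 2 * (v : ℝ) ≤ M := by exact_mod_cast h2
    refine Real.cos_le_cos_of_nonneg_of_le_pi (by positivity) ?_ ?_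
    · rw [div_le_iff₀ hM0]
      nlinarith [Real.pi_pos]
    · exact div_le_div_of_nonneg_right (by nlinarith [Real.pi_pos]) hM0.le
  · push Not at h2
    have h2' : (M : ℝ) < 2 * v := by exact_mod_cast h2
    have hrefl : Real.cos (2 * Real.pi * (v : ℝ) / M) = Real.cos (2 * Real.pi * ((M : ℝ) - v) / M) := by
      rw [show 2 * Real.pi * ((M : ℝ) - v) / M = 2 * Real.pi - 2 * Real.pi * (v : ℝ) / M by field_simp,
        Real.cos_two_pi_sub]
    rw [hrefl]
    refine Real.cos_le_cos_of_nonneg_of_le_pi (by positivity) ?_ ?_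
    · rw [div_le_iff₀ hM0]
      nlinarith [Real.pi_pos]
    · exact div_le_div_of_nonneg_right (by nlinarith [Real.pi_pos]) hM0.le

/-- A residue outside the centred block of half-width `m - 1` has representative in `[m, M - m]`
(`1 ≤ m`, `2m ≤ M`). [folklore] -/
theorem val_mem_middle_of_not_mem_block {m : ℕ} (hm1 : 1 ≤ m) {b : ZMod M}
    (hb : b ∉ ((Finset.range (2 * (m - 1) + 1)).image fun j : ℕ => ((j : ZMod M) - ((m - 1 : ℕ) : ZMod M)))) :
    m ≤ b.val ∧ b.val + m ≤ M := by
  have hval : b.val < M := ZMod.val_lt b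
  by_contra hcon
  rw [not_and_or, not_le, not_le] at hcon
  apply hb
  rw [Finset.mem_image]
  rcases hcon with h | h
  · -- `b.val < m`: `b = (b.val + (m-1)) - (m-1)`
    refine ⟨b.val + (m - 1), Finset.mem_range.2 (by omega), ?_⟩
    push_cast
    rw [ZMod.natCast_zmod_val, Nat.cast_sub hm1]
    push_cast
    ring
  · -- `b.val > M - m`: `b = -(M - b.val) = (m - 1 - (M - b.val)) - (m - 1)`
    refine ⟨m - 1 - (M - b.val), Finset.mem_range.2 (by omega), ?_⟩
    rw [Nat.cast_sub (by omega), Nat.cast_sub hm1, Nat.cast_sub hval.le, ZMod.natCast_self,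
      ZMod.natCast_zmod_val]
    push_cast
    ring

/-- **The dual transverse Fermi level**: with `c = cos(2πm/M)` (`1 ≤ m`, `2m ≤ M`),
`Σ_{b ∈ ℤ/M} (2cos(2πb/M) - 2c)₊ = 2S(m-1,M) - (2m-1)·2c` — only the centred block of half-width
`m - 1` contributes. [folklore] -/
theorem sum_posPart_two_cos_sub_eq {m : ℕ} (hm1 : 1 ≤ m) (hm : 2 * m ≤ M) :
    ∑ b : ZMod M, max (2 * Real.cos (2 * Real.pi * (b.val : ℝ) / M) - 2 * Real.cos (2 * Real.pi * (m : ℝ) / M)) 0 =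
      2 * (Real.sin ((2 * ((m - 1 : ℕ) : ℝ) + 1) * Real.pi / M) / Real.sin (Real.pi / M)) -
        (2 * ((m - 1 : ℕ) : ℝ) + 1) * (2 * Real.cos (2 * Real.pi * (m : ℝ) / M)) := by
  have hM : 2 ≤ M := by omega
  have hblk : 2 * (m - 1) + 1 ≤ M := by omega
  rw [← Finset.sum_filter_add_sum_filter_not Finset.univ (fun b : ZMod M => b ∈ ((Finset.range (2 * (m - 1) + 1)).image fun j : ℕ => ((j : ZMod M) - ((m - 1 : ℕ) : ZMod M)))),
    Finset.filter_mem_eq_inter, Finset.univ_inter]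
  -- inside the block the positive part is the argument
  have hin : ∀ b ∈ ((Finset.range (2 * (m - 1) + 1)).image fun j : ℕ => ((j : ZMod M) - ((m - 1 : ℕ) : ZMod M))),
      max (2 * Real.cos (2 * Real.pi * (b.val : ℝ) / M) - 2 * Real.cos (2 * Real.pi * (m : ℝ) / M)) 0 =
        2 * Real.cos (2 * Real.pi * (b.val : ℝ) / M) - 2 * Real.cos (2 * Real.pi * (m : ℝ) / M) := by
    intro b hb
    refine max_eq_left ?_
    obtain ⟨j, hj, rfl⟩ := Finset.mem_image.1 hb
    rw [Finset.mem_range] at hj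
    have hz : (((j : ZMod M) - ((m - 1 : ℕ) : ZMod M))) = (((j : ℤ) - ((m - 1 : ℕ) : ℤ) : ℤ) : ZMod M) := by
      push_cast; ring
    rw [hz, cos_two_pi_mul_val_intCast]
    have habs : |(j : ℤ) - ((m - 1 : ℕ) : ℤ)| ≤ (m : ℤ) := by
      rw [abs_le]; constructor <;> omega
    have := cos_ge_of_abs_le M hm (by omega) habs
    push_cast at this ⊢
    linarith
  -- outside the block it vanishes
  have hout : ∀ b ∈ Finset.univ.filter (fun b : ZMod M => ¬ b ∈ ((Finset.range (2 * (m - 1) + 1)).image fun j : ℕ => ((j : ZMod M) - ((m - 1 : ℕ) : ZMod M)))),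
      max (2 * Real.cos (2 * Real.pi * (b.val : ℝ) / M) - 2 * Real.cos (2 * Real.pi * (m : ℝ) / M)) 0 = 0 := by
    intro b hb
    rw [Finset.mem_filter] at hb
    refine max_eq_right ?_
    obtain ⟨h1, h2⟩ := val_mem_middle_of_not_mem_block M hm1 hb.2
    have := cos_le_of_mem_middle M h1 h2
    linarith
  rw [Finset.sum_congr rfl hin, Finset.sum_congr rfl hout, Finset.sum_const_zero, add_zero,
    Finset.sum_sub_distrib, Finset.sum_const, card_block (N := M) (m - 1) hblk, nsmul_eq_mul,
    ← Finset.mul_sum, sum_block_cos_eq (N := M) (m - 1) hM hblk]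
  push_cast
  ring

end TransverseBand

end Summit.HubbardSuperconductivity.HubbardSuperconductivity.Theorems.WidthHaldane

end
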